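import Mathlib.Analysis.SpecialFunctions.SmoothTransition
import Mathlib.Analysis.Calculus.ContDiff.Deriv
import Mathlib.Analysis.Calculus.Deriv.MeanValue
import Mathlib.Analysis.Calculus.Deriv.Slope
import Mathlib.MeasureTheory.Integral.IntervalIntegral.FundThmCalculus
import HarnessLib

/-!
# A smooth convex cut-off: constant near `0`, the identity beyond `ε`

Topic `Literature/Analysis/Calculus`. For every `ε > 0` there is a smooth function
`f_ε : ℝ → ℝ` which is **positive**, **constant on `(−∞, ε/2]`**, **equal to `x` for `x ≥ ε`**,
**convex** (`f_ε'' ≥ 0`) with `0 ≤ f_ε' ≤ 1`, and which therefore satisfies `f_ε ≤ ε` on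
`(−∞, ε]` and the tangent-line bounds `0 ≤ f_ε(x) − x f_ε'(x) ≤ ε` for `x ≥ 0`
(`exists_smooth_convex_cutoff`). This is the regularisation used to smooth `|W⁺|^{1/3}` at the
zero locus of `W⁺` in Gursky–LeBrun 1999, proof of Lemma 4 ("for each `ε > 0`, let
`f_ε : [0,∞) → (0,∞)` be a smooth positive function which is constant on `[0,ε/2]`, satisfies
`f_ε(x) = x` for `x > ε`, and has non-negative second derivative everywhere"), whose existence is
asserted there without proof; the same device regularises `|s|^p`-type functions elsewhere.

Construction: `φ(x) = smoothTransition(2x/ε − 1)` (Mathlib's smooth monotone transition, `0` on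
`(−∞, ε/2]`, `1` on `[ε, ∞)`) and `f(x) = x − ∫_ε^x (1 − φ(t)) dt`, so that `f' = φ`.

No definitions and no statements of `Prop` type are introduced (an existence theorem).

## References

* M. J. Gursky, C. LeBrun, *On Einstein manifolds of positive sectional curvature*, Ann. Global
  Anal. Geom. 17 (1999) 315–328 (arXiv:math/9807055), §3, proof of Lemma 4. [GurskyLebrun1999]
-/

noncomputable section

open Set Real intervalIntegral MeasureTheory
open scoped ContDiff Topology

namespace Literature.Analysis.Calculus

/-- **A smooth convex cut-off** (the `f_ε` of Gursky–LeBrun 1999, proof of Lemma 4, with its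
properties made explicit): for `ε > 0` there is `f : ℝ → ℝ` of class `C^∞` with
(1) `f > 0`; (2) `f(x) = f(0)` for `x ≤ ε/2`; (3) `f(x) = x` for `x ≥ ε`; (4) `0 ≤ f' ≤ 1`;
(5) `f'' ≥ 0`; (6) `f(x) ≤ ε` for `x ≤ ε`; (7) `0 ≤ f(x) − x f'(x) ≤ ε` for `x ≥ 0`.
[cite: GurskyLebrun1999, §3, proof of Lemma 4] -/
theorem exists_smooth_convex_cutoff {ε : ℝ} (hε : 0 < ε) :
    ∃ f : ℝ → ℝ, ContDiff ℝ ∞ f ∧ (∀ x, 0 < f x) ∧ (∀ x, x ≤ ε / 2 → f x = f 0) ∧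
      (∀ x, ε ≤ x → f x = x) ∧ (∀ x, 0 ≤ deriv f x ∧ deriv f x ≤ 1) ∧
      (∀ x, 0 ≤ deriv (deriv f) x) ∧ (∀ x, x ≤ ε → f x ≤ ε) ∧
      (∀ x, 0 ≤ x → 0 ≤ f x - x * deriv f x ∧ f x - x * deriv f x ≤ ε) := by
  -- the profile `φ = f'`
  set φ : ℝ → ℝ := fun x ↦ smoothTransition (2 * x / ε - 1) with hφ_def
  have hφ_smooth : ContDiff ℝ ∞ φ :=
    Real.smoothTransition.contDiff.comp ((contDiff_const.mul contDiff_id).div_const _ |>.sub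
      contDiff_const)
  have hφ_cont : Continuous φ := hφ_smooth.continuous
  have hφ_zero : ∀ x, x ≤ ε / 2 → φ x = 0 := fun x hx ↦ by
    apply smoothTransition.zero_of_nonpos
    rw [sub_nonpos, div_le_one hε]
    linarith
  have hφ_one : ∀ x, ε ≤ x → φ x = 1 := fun x hx ↦ by
    apply smoothTransition.one_of_one_le
    rw [le_sub_iff_add_le, le_div_iff₀ hε]
    linarith
  have hφ_nonneg : ∀ x, 0 ≤ φ x := fun x ↦ smoothTransition.nonneg _
  have hφ_le_one : ∀ x, φ x ≤ 1 := fun x ↦ smoothTransition.le_one _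
  have hφ_lt_one : ∀ x, x < ε → φ x < 1 := fun x hx ↦ by
    apply smoothTransition.lt_one_of_lt_one
    rw [sub_lt_iff_lt_add, div_lt_iff₀ hε]
    linarith
  have hφ_mono : Monotone φ := fun x y hxy ↦
    Real.smoothTransition.monotone (by
      apply sub_le_sub_right
      exact div_le_div_of_nonneg_right (by linarith) hε.le)
  -- the cut-off
  set f : ℝ → ℝ := fun x ↦ x - ∫ t in ε..x, (1 - φ t) with hf_def
  have hI : ∀ x, HasDerivAt (fun u ↦ ∫ t in ε..u, (1 - φ t)) (1 - φ x) x := fun x ↦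
    ((continuous_const.sub hφ_cont).integral_hasStrictDerivAt ε x).hasDerivAt
  have hf_deriv : ∀ x, HasDerivAt f (φ x) x := fun x ↦ by
    have h2 : HasDerivAt (fun y ↦ y - ∫ t in ε..y, (1 - φ t)) (1 - (1 - φ x)) x :=
      (hasDerivAt_id' x).sub (hI x)
    rwa [sub_sub_cancel] at h2
  have hderiv : deriv f = φ := funext fun x ↦ (hf_deriv x).deriv
  have hf_diff : Differentiable ℝ f := fun x ↦ (hf_deriv x).differentiableAt
  have hf_smooth : ContDiff ℝ ∞ f := by
    rw [contDiff_infty_iff_deriv]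
    exact ⟨hf_diff, by rwa [hderiv]⟩
  have hf_mono : Monotone f := monotone_of_deriv_nonneg hf_diff fun x ↦ by
    rw [hderiv]; exact hφ_nonneg x
  -- (3) `f = id` beyond `ε`
  have hf_id : ∀ x, ε ≤ x → f x = x := fun x hx ↦ by
    have h0 : ∫ t in ε..x, (1 - φ t) = 0 := by
      rw [show (0 : ℝ) = ∫ _ in ε..x, (0 : ℝ) by simp]
      refine integral_congr fun t ht ↦ ?_
      rw [uIcc_of_le hx] at ht
      simp [hφ_one t ht.1]
    simp [hf_def, h0]
  -- (2) `f` is constant on `(−∞, ε/2]`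
  have hf_const : ∀ x, x ≤ ε / 2 → f x = f 0 := fun x hx ↦ by
    have hsub : (∫ t in ε..x, (1 - φ t)) - ∫ t in ε..(0 : ℝ), (1 - φ t) =
        ∫ t in (0 : ℝ)..x, (1 - φ t) :=
      integral_interval_sub_left ((continuous_const.sub hφ_cont).intervalIntegrable _ _)
        ((continuous_const.sub hφ_cont).intervalIntegrable _ _)
    have hx1 : ∫ t in (0 : ℝ)..x, (1 - φ t) = x := by
      have : ∫ t in (0 : ℝ)..x, (1 - φ t) = ∫ _ in (0 : ℝ)..x, (1 : ℝ) := by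
        refine integral_congr fun t ht ↦ ?_
        have htε : t ≤ ε / 2 := by
          rcases le_total 0 x with h0x | hx0
          · rw [uIcc_of_le h0x] at ht; exact ht.2.trans hx
          · rw [uIcc_of_ge hx0] at ht; exact ht.2.trans (by linarith)
        simp [hφ_zero t htε]
      rw [this, intervalIntegral.integral_const, smul_eq_mul, mul_one, sub_zero]
    simp only [hf_def]
    linarith
  -- (1) positivity: `f 0 = ∫₀^ε (1 − φ) > 0`
  have hf0_pos : 0 < f 0 := by
    have : f 0 = ∫ t in (0 : ℝ)..ε, (1 - φ t) := by
      simp only [hf_def, integral_symm ε 0]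
      ring
    rw [this]
    exact intervalIntegral_pos_of_pos_on ((continuous_const.sub hφ_cont).intervalIntegrable _ _)
      (fun t ht ↦ by linarith [hφ_lt_one t ht.2]) hε
  have hf_pos : ∀ x, 0 < f x := fun x ↦ by
    rcases le_total x 0 with hx | hx
    · rw [hf_const x (hx.trans (by linarith))]; exact hf0_pos
    · exact hf0_pos.trans_le (hf_mono hx)
  -- (7) the tangent-line function `g = f − x f'` is antitone on `[0, ∞)`
  set g : ℝ → ℝ := fun x ↦ f x - x * φ x with hg_def
  have hφ_deriv : ∀ x, HasDerivAt φ (deriv φ x) x := fun x ↦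
    ((hφ_smooth.differentiable (by simp)) x).hasDerivAt
  have hg_deriv : ∀ x, HasDerivAt g (-(x * deriv φ x)) x := fun x ↦ by
    have h2 : HasDerivAt (fun y ↦ f y - y * φ y) (φ x - (1 * φ x + x * deriv φ x)) x :=
      (hf_deriv x).sub ((hasDerivAt_id' x).mul (hφ_deriv x))
    have h3 : φ x - (1 * φ x + x * deriv φ x) = -(x * deriv φ x) := by ring
    rwa [h3] at h2
  have hg_anti : AntitoneOn g (Ici 0) :=
    antitoneOn_of_deriv_nonpos (convex_Ici 0)
      (fun x _ ↦ (hg_deriv x).continuousAt.continuousWithinAt)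
      (fun x _ ↦ (hg_deriv x).differentiableAt.differentiableWithinAt)
      fun x hx ↦ by
        rw [interior_Ici] at hx
        rw [(hg_deriv x).deriv, neg_nonpos]
        exact mul_nonneg hx.le hφ_mono.deriv_nonneg
  have hg_ε : g ε = 0 := by
    simp only [hg_def, hf_id ε le_rfl, hφ_one ε le_rfl]
    ring
  have hg_0 : g 0 = f 0 := by simp [hg_def]
  have hf0_le : f 0 ≤ ε := by
    have := hf_mono (show (0 : ℝ) ≤ ε from hε.le)
    rwa [hf_id ε le_rfl] at this
  refine ⟨f, hf_smooth, hf_pos, hf_const, hf_id, fun x ↦ ?_, fun x ↦ ?_, fun x hx ↦ ?_,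
    fun x hx ↦ ?_⟩
  · rw [hderiv]; exact ⟨hφ_nonneg x, hφ_le_one x⟩
  · rw [hderiv]; exact hφ_mono.deriv_nonneg
  · calc f x ≤ f ε := hf_mono hx
      _ = ε := hf_id ε le_rfl
  · rw [hderiv]
    change 0 ≤ g x ∧ g x ≤ ε
    rcases le_total x ε with hxε | hεx
    · constructor
      · rw [← hg_ε]; exact hg_anti hx hε.le hxε
      · calc g x ≤ g 0 := hg_anti (le_refl (0 : ℝ)) hx hx
          _ = f 0 := hg_0
          _ ≤ ε := hf0_le
    · have : g x = 0 := by
        simp only [hg_def, hf_id x hεx, hφ_one x hεx]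
        ring
      rw [this]
      exact ⟨le_rfl, hε.le⟩

end Literature.Analysis.Calculus

end
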